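import Summits.Ventures.PercRepro.RLSRuleLineFreeSupply
import Summits.Ventures.PercRepro.RLSGenericT3Sums

/-!
# PercRepro — `R₃⁺` on line-free planes of every type: the binomial bookkeeping (night-3, gen 3)

Pure arithmetic over `ℚ`, no matroid: the supply sum of `RLSRuleLineFreeSupply.lean` grouped by the size of `B′`
(`sum_powerset_lbShare`) is the pure-form right side of the lane's family theorems (`U3.generic_t3` etc.), and the
demand count (`demandCount_eq`) is their left factor:

* `lbShare_three` / `lbShare_four` / `lbShare_five` / `lbShare_of_six_le`: the values of `lbShare`;
* `sum_Ico_choose_eq`: `Σ_{6 ≤ b ≤ g} C(g, b) = 2^g − 1 − g − C(g, 2) − C(g, 3) − C(g, 4) − C(g, 5)`;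
* **`sum_powerset_lbShare`**: for `g ≥ 6`,
  `Σ_{b ≤ g} C(g, b) · Σ_{i < n} C(k, i + 1) · lbShare b (i + 1) = C(g, 3)·T₀ + 4C(g, 4)·T₁ + 10C(g, 5)·T₂ + (Σ_{b ≥ 6} C(g, b))·W`
  with `T_j = Σ_{i < n} C(k, i + 1)/C(i + 4 + j, 3)` and `W = Σ_{i < n} C(k, i + 1)`;
* **`demandCount_eq`**: for `3 + t ≤ g`, `demandCount g t = 2^g − (1 + g + C(g, 2)) − Σ_{j < t} C(g, j)`.
Imports `RLSRuleLineFreeSupply`, `RLSGenericT3Sums` (for `U3.sum_range_six`).  Axioms: standard.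
-/

namespace PercRepro

namespace NightThree

open Finset

/-! ### The values of `lbShare` -/

/-- `lbShare 3 x = 1 / C(x + 3, 3)`. -/
theorem lbShare_three (x : ℕ) : lbShare 3 x = 1 / ((x + 3).choose 3 : ℚ) := by
  unfold lbShare
  rw [if_neg (by norm_num), if_pos (by norm_num), add_comm 3 x]
  norm_num

/-- `lbShare 4 x = 4 / C(x + 4, 3)`. -/
theorem lbShare_four (x : ℕ) : lbShare 4 x = 4 / ((x + 4).choose 3 : ℚ) := by
  unfold lbShare
  rw [if_neg (by norm_num), if_pos (by norm_num), add_comm 4 x]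
  norm_num [Nat.choose]

/-- `lbShare 5 x = 10 / C(x + 5, 3)`. -/
theorem lbShare_five (x : ℕ) : lbShare 5 x = 10 / ((x + 5).choose 3 : ℚ) := by
  unfold lbShare
  rw [if_neg (by norm_num), if_pos (by norm_num), add_comm 5 x]
  norm_num [Nat.choose]

/-- `lbShare b x = 1` for `b ≥ 6`. -/
theorem lbShare_of_six_le {b : ℕ} (h : 6 ≤ b) (x : ℕ) : lbShare b x = 1 := by
  unfold lbShare
  rw [if_neg (by omega), if_neg (by omega)]

/-! ### Binomial sums -/

/-- `Σ_{b ≤ g} C(g, b) = 2^g` in `ℚ`. -/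
theorem sum_range_choose_cast (g : ℕ) : ∑ b ∈ range (g + 1), (g.choose b : ℚ) = 2 ^ g := by
  exact_mod_cast Nat.sum_range_choose g

/-- `Σ_{6 ≤ b ≤ g} C(g, b) = 2^g − 1 − g − C(g, 2) − C(g, 3) − C(g, 4) − C(g, 5)` for `g ≥ 5`. -/
theorem sum_Ico_choose_eq {g : ℕ} (hg : 5 ≤ g) :
    ∑ b ∈ Finset.Ico 6 (g + 1), (g.choose b : ℚ) =
      2 ^ g - 1 - (g : ℚ) - (g.choose 2 : ℚ) - (g.choose 3 : ℚ) - (g.choose 4 : ℚ) - (g.choose 5 : ℚ) := by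
  have h := Finset.sum_range_add_sum_Ico (fun b => (g.choose b : ℚ)) (show 6 ≤ g + 1 by omega)
  rw [sum_range_choose_cast, U3.sum_range_six] at h
  linarith

/-- **The supply sum grouped by the size of `B′`** equals the pure-form right side of the family theorems. -/
theorem sum_powerset_lbShare {g : ℕ} (hg : 6 ≤ g) (k n : ℕ) :
    ∑ b ∈ range (g + 1), (g.choose b : ℚ) * (∑ i ∈ range n, (k.choose (i + 1) : ℚ) * lbShare b (i + 1)) =
      (g.choose 3 : ℚ) * (∑ i ∈ range n, (k.choose (i + 1) : ℚ) / ((i + 4).choose 3 : ℚ)) +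
        4 * (g.choose 4 : ℚ) * (∑ i ∈ range n, (k.choose (i + 1) : ℚ) / ((i + 5).choose 3 : ℚ)) +
        10 * (g.choose 5 : ℚ) * (∑ i ∈ range n, (k.choose (i + 1) : ℚ) / ((i + 6).choose 3 : ℚ)) +
        (2 ^ g - 1 - (g : ℚ) - (g.choose 2 : ℚ) - (g.choose 3 : ℚ) - (g.choose 4 : ℚ) - (g.choose 5 : ℚ)) *
          (∑ i ∈ range n, (k.choose (i + 1) : ℚ)) := by
  rw [← Finset.sum_range_add_sum_Ico _ (show 6 ≤ g + 1 by omega)]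
  -- the six small sizes
  have h0 : ∀ b ≤ 2, (∑ i ∈ range n, (k.choose (i + 1) : ℚ) * lbShare b (i + 1)) = 0 := by
    intro b hb
    apply Finset.sum_eq_zero
    intro i _
    rw [lbShare_of_le_two hb, mul_zero]
  have h3 : (∑ i ∈ range n, (k.choose (i + 1) : ℚ) * lbShare 3 (i + 1)) =
      ∑ i ∈ range n, (k.choose (i + 1) : ℚ) / ((i + 4).choose 3 : ℚ) := by
    apply Finset.sum_congr rfl
    intro i _
    rw [lbShare_three, show i + 1 + 3 = i + 4 by omega, mul_one_div]
  have h4 : (∑ i ∈ range n, (k.choose (i + 1) : ℚ) * lbShare 4 (i + 1)) =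
      4 * ∑ i ∈ range n, (k.choose (i + 1) : ℚ) / ((i + 5).choose 3 : ℚ) := by
    rw [Finset.mul_sum]
    apply Finset.sum_congr rfl
    intro i _
    rw [lbShare_four, show i + 1 + 4 = i + 5 by omega]
    ring
  have h5 : (∑ i ∈ range n, (k.choose (i + 1) : ℚ) * lbShare 5 (i + 1)) =
      10 * ∑ i ∈ range n, (k.choose (i + 1) : ℚ) / ((i + 6).choose 3 : ℚ) := by
    rw [Finset.mul_sum]
    apply Finset.sum_congr rfl
    intro i _
    rw [lbShare_five, show i + 1 + 5 = i + 6 by omega]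
    ring
  -- the large sizes: share `1`
  have hbig : ∀ b ∈ Finset.Ico 6 (g + 1),
      (g.choose b : ℚ) * (∑ i ∈ range n, (k.choose (i + 1) : ℚ) * lbShare b (i + 1)) =
        (g.choose b : ℚ) * (∑ i ∈ range n, (k.choose (i + 1) : ℚ)) := by
    intro b hb
    rw [Finset.mem_Ico] at hb
    congr 1
    apply Finset.sum_congr rfl
    intro i _
    rw [lbShare_of_six_le hb.1, mul_one]
  rw [Finset.sum_congr rfl hbig, ← Finset.sum_mul, sum_Ico_choose_eq (by omega)]
  simp only [Finset.sum_range_succ, Finset.range_zero, Finset.sum_empty]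
  rw [h0 0 (by norm_num), h0 1 (by norm_num), h0 2 (by norm_num), h3, h4, h5]
  ring

/-! ### The demand count -/

/-- **The demand count**: for `3 + t ≤ g`, `demandCount g t = 2^g − (1 + g + C(g, 2)) − Σ_{j < t} C(g, j)`. -/
theorem demandCount_eq {g t : ℕ} (h : 3 + t ≤ g) :
    demandCount g t = 2 ^ g - (1 + (g : ℚ) + (g.choose 2 : ℚ)) - ∑ j ∈ range t, (g.choose j : ℚ) := by
  unfold demandCount
  -- the indicator `[3 ≤ b ∧ b + t ≤ g]` is `1 − [b ≤ 2] − [g < b + t]` (the two bad events are disjoint)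
  have hind : ∀ b ∈ range (g + 1),
      (g.choose b : ℚ) * (if 3 ≤ b ∧ b + t ≤ g then 1 else 0) =
        (g.choose b : ℚ) - (g.choose b : ℚ) * (if b ≤ 2 then 1 else 0) -
          (g.choose b : ℚ) * (if g < b + t then 1 else 0) := by
    intro b _
    by_cases h2 : b ≤ 2
    · rw [if_neg (by omega), if_pos h2, if_neg (by omega)]
      ring
    · by_cases h3 : g < b + t
      · rw [if_neg (by omega), if_neg h2, if_pos h3]
        ring
      · rw [if_pos ⟨by omega, by omega⟩, if_neg h2, if_neg h3]
        ring
  rw [Finset.sum_congr rfl hind, Finset.sum_sub_distrib, Finset.sum_sub_distrib, sum_range_choose_cast]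
  -- the small sizes
  have hsmall : ∑ b ∈ range (g + 1), (g.choose b : ℚ) * (if b ≤ 2 then 1 else 0) =
      1 + (g : ℚ) + (g.choose 2 : ℚ) := by
    rw [← Finset.sum_range_add_sum_Ico _ (show 3 ≤ g + 1 by omega)]
    have hz : ∑ b ∈ Finset.Ico 3 (g + 1), (g.choose b : ℚ) * (if b ≤ 2 then 1 else 0) = 0 := by
      apply Finset.sum_eq_zero
      intro b hb
      rw [Finset.mem_Ico] at hb
      rw [if_neg (by omega), mul_zero]
    rw [hz, add_zero]
    simp [Finset.sum_range_succ]
  -- the large sizes: reflect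
  have hlarge : ∑ b ∈ range (g + 1), (g.choose b : ℚ) * (if g < b + t then 1 else 0) =
      ∑ j ∈ range t, (g.choose j : ℚ) := by
    rw [← Finset.sum_range_add_sum_Ico _ (show g + 1 - t ≤ g + 1 by omega)]
    have hz : ∑ b ∈ range (g + 1 - t), (g.choose b : ℚ) * (if g < b + t then 1 else 0) = 0 := by
      apply Finset.sum_eq_zero
      intro b hb
      rw [Finset.mem_range] at hb
      rw [if_neg (by omega), mul_zero]
    rw [hz, zero_add]
    have hone : ∀ b ∈ Finset.Ico (g + 1 - t) (g + 1),
        (g.choose b : ℚ) * (if g < b + t then 1 else 0) = (g.choose b : ℚ) := by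
      intro b hb
      rw [Finset.mem_Ico] at hb
      rw [if_pos (by omega), mul_one]
    rw [Finset.sum_congr rfl hone, Finset.sum_Ico_eq_sum_range, show g + 1 - (g + 1 - t) = t by omega]
    rw [← Finset.sum_range_reflect (fun j => (g.choose j : ℚ)) t]
    apply Finset.sum_congr rfl
    intro j hj
    rw [Finset.mem_range] at hj
    have hidx : g + 1 - t + j = g - (t - 1 - j) := by omega
    rw [hidx, Nat.choose_symm (show t - 1 - j ≤ g by omega)]
  rw [hsmall, hlarge]

end NightThree

end PercRepro
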